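import Summits.AtomisticToContinuum.Crystallization.Theses.PerronTransitivity

/-!
# Crux `TransitiveLocalLimit` (stmt-AtomisticToContinuum-15100), line `birth` — stub `stub_concentration_of_superBoundSparse`

STUB 2 of the skeleton `Cruxes/TransitiveLocalLimit/Lines/birth.lean` (the pinned average kills the
sub-bound sites): along a sequence of Lennard-Jones ground states `x N` in `ℝ³`, if for every `θ > 0`
the `θ`-SUPER-bound sites (`𝓔ⁱ ≤ 2E* − θ`, `E* = ⨅_Q e_LJ(Q)`) have density `→ 0`, then for every
`θ > 0` the sites whose site energy is `θ`-far from `2E*` (on either side) have density `→ 0`.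

Proof. `Σ_i 𝓔ⁱ(x N) = 2·E(N)` (`two_mul_interactionEnergy`) and `E(N)/N → E*`
(`ChargedEnergyGapNegative.crysEnergyLimit`); the site energies of ground states are uniformly
bounded below, `𝓔ⁱ ≥ −C` (uniform minimal distance `LennardJonesMinimalDistance_holds`, attractive
tail `neg_le_lennardJones_of_le`, shell sum `sum_inv_pow_six_le`).  For `θ, θ' > 0` the pointwise
inequality `θ·1{θ < 𝓔ⁱ − 2E*} ≤ (𝓔ⁱ − 2E*) + (C + 2E*)·1{𝓔ⁱ ≤ 2E* − θ'} + θ'`, summed over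
`i`, gives `θ·#sub(θ) ≤ 2(E(N) − N·E*) + (C + 2E*)·#super(θ') + θ'·N`; with `θ' = θε/2` the right-hand
side divided by `θN` is eventually `< ε`, so `#sub(θ)/N → 0`.  Finally
`{θ < |𝓔ⁱ − 2E*|} ⊆ sub(θ) ∪ super(θ)`.
-/

noncomputable section

namespace Summit.AtomisticToContinuum.Crystallization.Theorems.TransitiveLocalLimitBirth

open Literature.MathematicalPhysics.StatisticalMechanics Filter

/-- Uniform lower bound on the site energies of Lennard-Jones ground states in `ℝ³`: with the
uniform minimal distance `δ` of `LennardJonesMinimalDistance_holds` and the shell sum,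
`𝓔ⁱ(y) ≥ −(1/6)·250·δ⁻⁶` for every ground state `y` and every particle `i`. -/
theorem exists_neg_le_siteEnergy :
    ∃ C : ℝ, ∀ (N : ℕ) (y : Fin N → EuclideanSpace ℝ (Fin 3)),
      IsGroundState lennardJones y → ∀ i, -C ≤ siteEnergy lennardJones y i := by
  obtain ⟨δ, hδ, hsep⟩ := LennardJonesMinimalDistance_holds
  refine ⟨(1 / 6) * (250 * δ⁻¹ ^ 6), fun N y hy i => ?_⟩
  have hsep' : ∀ k l, k ≠ l → δ ≤ dist (y k) (y l) := hsep N y hy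
  have hS := sum_inv_pow_six_le y hδ hsep' i
  have hterm : ∀ k ∈ Finset.univ.erase i,
      -((1 / 6) * (dist (y i) (y k))⁻¹ ^ 6) ≤ lennardJones (dist (y i) (y k)) := fun k hk =>
    neg_le_lennardJones_of_le (hδ.trans_le (hsep' i k (Finset.ne_of_mem_erase hk).symm)) le_rfl
  calc -((1 / 6) * (250 * δ⁻¹ ^ 6))
      ≤ -((1 / 6) * ∑ k ∈ Finset.univ.erase i, (dist (y i) (y k))⁻¹ ^ 6) := by linarith
    _ = ∑ k ∈ Finset.univ.erase i, -((1 / 6) * (dist (y i) (y k))⁻¹ ^ 6) := by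
      rw [Finset.mul_sum, Finset.sum_neg_distrib]
    _ ≤ siteEnergy lennardJones y i := Finset.sum_le_sum hterm

/-- The counting inequality behind the stub: if `u i ≥ −C` for all `i` and `θ' > 0`, then
`θ·#{θ < u i − L} ≤ (Σ_i u i − N·L) + (C + L)·#{u i ≤ L − θ'} + θ'·N` — the sum over `i` of the
pointwise inequality `θ·1{θ < u i − L} ≤ (u i − L) + (C + L)·1{u i ≤ L − θ'} + θ'` (on the set
`{θ < u i − L} ∩ {u i ≤ L − θ'}` one has `θ < −θ' < θ' ≤ u i + C + θ'`). -/
theorem mul_card_filter_le {N : ℕ} (u : Fin N → ℝ) {L C θ θ' : ℝ} (hθ' : 0 < θ')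
    (hu : ∀ i, -C ≤ u i) :
    θ * ((Finset.univ.filter fun i => θ < u i - L).card : ℝ) ≤
      ((∑ i, u i) - N * L) + (C + L) * ((Finset.univ.filter fun i => u i ≤ L - θ').card : ℝ)
        + θ' * N := by
  rw [Finset.natCast_card_filter, Finset.natCast_card_filter, Finset.mul_sum, Finset.mul_sum]
  have hN : (N : ℝ) * L = ∑ _i : Fin N, L := by simp
  have hN' : θ' * (N : ℝ) = ∑ _i : Fin N, θ' := by simp [mul_comm]
  rw [hN, hN', ← Finset.sum_sub_distrib, ← Finset.sum_add_distrib, ← Finset.sum_add_distrib]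
  refine Finset.sum_le_sum fun i _ => ?_
  have hi := hu i
  split_ifs <;> linarith

/-- Density of the `θ`-SUB-bound sites (`θ < 𝓔ⁱ − 2E*`) tends to `0` along a sequence of
Lennard-Jones ground states, provided the density of the `θ'`-super-bound sites (`𝓔ⁱ ≤ 2E* − θ'`)
tends to `0` for every `θ' > 0`: pinned average `Σ_i 𝓔ⁱ = 2E(N) = 2E*·N + o(N)` plus the uniform
lower bound on site energies. -/
theorem tendsto_density_subBound (x : (N : ℕ) → (Fin N → EuclideanSpace ℝ (Fin 3)))
    (hx : ∀ N, IsGroundState lennardJones (x N))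
    (hsup : ∀ θ : ℝ, 0 < θ → Tendsto (fun N : ℕ => ((Finset.univ.filter fun i : Fin N =>
      siteEnergy lennardJones (x N) i ≤
        2 * (⨅ Q : PeriodicConfiguration 3, Q.energyPerParticle lennardJones) - θ).card : ℝ) / N)
      atTop (nhds 0))
    {θ : ℝ} (hθ : 0 < θ) :
    Tendsto (fun N : ℕ => ((Finset.univ.filter fun i : Fin N =>
      θ < siteEnergy lennardJones (x N) i -
        2 * (⨅ Q : PeriodicConfiguration 3, Q.energyPerParticle lennardJones)).card : ℝ) / N)
      atTop (nhds 0) := by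
  set E : ℝ := ⨅ Q : PeriodicConfiguration 3, Q.energyPerParticle lennardJones
  have hEl : Tendsto (fun N : ℕ => groundStateEnergy lennardJones 3 N / N) atTop (nhds E) :=
    ChargedEnergyGapNegative.crysEnergyLimit
  obtain ⟨C, hC⟩ := exists_neg_le_siteEnergy
  have hθ0 : θ ≠ 0 := hθ.ne'
  -- the pointwise-in-`N` bound, for every auxiliary `θ' > 0`
  have hbound : ∀ θ' : ℝ, 0 < θ' → ∀ N : ℕ, 0 < N →
      ((Finset.univ.filter fun i : Fin N =>
          θ < siteEnergy lennardJones (x N) i - 2 * E).card : ℝ) / N ≤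
        (2 * (groundStateEnergy lennardJones 3 N / N) - 2 * E +
          (C + 2 * E) * (((Finset.univ.filter fun i : Fin N =>
            siteEnergy lennardJones (x N) i ≤ 2 * E - θ').card : ℝ) / N) + θ') / θ := by
    intro θ' hθ' N hN
    have hNr : (0 : ℝ) < N := by exact_mod_cast hN
    have hN0 : (N : ℝ) ≠ 0 := hNr.ne'
    have key := mul_card_filter_le (siteEnergy lennardJones (x N)) (L := 2 * E) (θ := θ) hθ'
      fun i => hC N (x N) (hx N) i
    rw [← two_mul_interactionEnergy, (hx N).2] at key
    calc ((Finset.univ.filter fun i : Fin N =>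
          θ < siteEnergy lennardJones (x N) i - 2 * E).card : ℝ) / N
        = θ * ((Finset.univ.filter fun i : Fin N =>
          θ < siteEnergy lennardJones (x N) i - 2 * E).card : ℝ) / (θ * N) := by
          rw [mul_div_mul_left _ _ hθ0]
      _ ≤ (2 * groundStateEnergy lennardJones 3 N - N * (2 * E) +
            (C + 2 * E) * ((Finset.univ.filter fun i : Fin N =>
              siteEnergy lennardJones (x N) i ≤ 2 * E - θ').card : ℝ) + θ' * N) / (θ * N) :=
          div_le_div_of_nonneg_right key (by positivity)
      _ = _ := by
          field_simp
  refine Metric.tendsto_nhds.2 fun ε hε => ?_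
  have hθ' : 0 < θ * ε / 2 := by positivity
  have hlim : Tendsto (fun N : ℕ => (2 * (groundStateEnergy lennardJones 3 N / N) - 2 * E +
      (C + 2 * E) * (((Finset.univ.filter fun i : Fin N =>
        siteEnergy lennardJones (x N) i ≤ 2 * E - θ * ε / 2).card : ℝ) / N) + θ * ε / 2) / θ)
      atTop (nhds ((2 * E - 2 * E + (C + 2 * E) * 0 + θ * ε / 2) / θ)) :=
    ((((hEl.const_mul 2).sub_const (2 * E)).add ((hsup _ hθ').const_mul (C + 2 * E))).add_const
      (θ * ε / 2)).div_const θ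
  have hval : (2 * E - 2 * E + (C + 2 * E) * 0 + θ * ε / 2) / θ < ε := by
    have h : (2 * E - 2 * E + (C + 2 * E) * 0 + θ * ε / 2) / θ = ε / 2 := by
      field_simp
      ring
    rw [h]
    exact half_lt_self hε
  filter_upwards [hlim.eventually (gt_mem_nhds hval), eventually_gt_atTop 0] with N hN hN0
  rw [Real.dist_0_eq_abs, abs_of_nonneg (by positivity)]
  exact (hbound _ hθ' N hN0).trans_lt hN

/-- **STUB 2 — PINNED AVERAGE KILLS SUB-BOUND SITES** (registered signature of
`stub_concentration_of_superBoundSparse` in `Cruxes/TransitiveLocalLimit/Lines/birth.lean`): for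
Lennard-Jones ground states, if `θ`-super-bound sites have vanishing density for every `θ > 0` then
so do all sites whose energy is `θ`-FAR from `2E*` (two-sided concentration), since
`{θ < |𝓔ⁱ − 2E*|} ⊆ {θ < 𝓔ⁱ − 2E*} ∪ {𝓔ⁱ ≤ 2E* − θ}` and both densities tend to `0`
(`tendsto_density_subBound` and the hypothesis). -/
theorem stub_concentration_of_superBoundSparse : ∀ x : (N : ℕ) → (Fin N → EuclideanSpace ℝ (Fin 3)), (∀ N, Literature.MathematicalPhysics.StatisticalMechanics.IsGroundState Literature.MathematicalPhysics.StatisticalMechanics.lennardJones (x N)) → (∀ θ : ℝ, 0 < θ → Filter.Tendsto (fun N : ℕ => ((Finset.univ.filter fun i : Fin N => Literature.MathematicalPhysics.StatisticalMechanics.siteEnergy Literature.MathematicalPhysics.StatisticalMechanics.lennardJones (x N) i ≤ 2 * (⨅ Q : Literature.MathematicalPhysics.StatisticalMechanics.PeriodicConfiguration 3, Q.energyPerParticle Literature.MathematicalPhysics.StatisticalMechanics.lennardJones) - θ).card : ℝ) / N) Filter.atTop (nhds 0)) → ∀ θ : ℝ, 0 < θ → Filter.Tendsto (fun N : ℕ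 => ((Finset.univ.filter fun i : Fin N => θ < |Literature.MathematicalPhysics.StatisticalMechanics.siteEnergy Literature.MathematicalPhysics.StatisticalMechanics.lennardJones (x N) i - 2 * (⨅ Q : Literature.MathematicalPhysics.StatisticalMechanics.PeriodicConfiguration 3, Q.energyPerParticle Literature.MathematicalPhysics.StatisticalMechanics.lennardJones)|).card : ℝ) / N) Filter.atTop (nhds 0) := by
  intro x hx hsup θ hθ
  set E : ℝ := ⨅ Q : PeriodicConfiguration 3, Q.energyPerParticle lennardJones
  have hg := (tendsto_density_subBound x hx hsup hθ).add (hsup θ hθ)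
  rw [add_zero] at hg
  refine squeeze_zero (fun N => div_nonneg (Nat.cast_nonneg _) (Nat.cast_nonneg _))
    (fun N => ?_) hg
  have hsub : (Finset.univ.filter fun i : Fin N =>
        θ < |siteEnergy lennardJones (x N) i - 2 * E|) ⊆
      (Finset.univ.filter fun i : Fin N => θ < siteEnergy lennardJones (x N) i - 2 * E) ∪
        (Finset.univ.filter fun i : Fin N => siteEnergy lennardJones (x N) i ≤ 2 * E - θ) := by
    intro i hi
    rw [Finset.mem_union, Finset.mem_filter, Finset.mem_filter]
    rw [Finset.mem_filter] at hi
    rcases lt_abs.1 hi.2 with h | h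
    · exact Or.inl ⟨hi.1, h⟩
    · exact Or.inr ⟨hi.1, by linarith⟩
  rw [← add_div, ← Nat.cast_add]
  refine div_le_div_of_nonneg_right ?_ (Nat.cast_nonneg N)
  exact_mod_cast (Finset.card_le_card hsub).trans (Finset.card_union_le _ _)

end Summit.AtomisticToContinuum.Crystallization.Theorems.TransitiveLocalLimitBirth

end
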